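/-
Copyright (c) 2026. All rights reserved.
Released under Apache 2.0 license as described in the file LICENSE.
-/
import Literature.NumberTheory.GaloisRepresentations.TateDualityDevissage
import Literature.NumberTheory.GaloisRepresentations.ContinuousCohomologyNineTerm
import Literature.NumberTheory.GaloisRepresentations.LocalDualityDescent
import HarnessLib

/-!
# Local Tate duality in bidegree `(0, 2)`: the left kernel, by dévissage

Serre, *Cohomologie galoisienne*, II §5.2 Thm. 2 (Tate), case `i = 0`: for a finite discrete
module `M` over a `p`-adic field the pairing `H⁰(k, M) × H²(k, M^D) → H²(k, μ) = ℚ/ℤ` is perfect.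
This file proves the **abstract dévissage for the LEFT kernel** of the degree `(0, 2)` pairing
`(w, z) ↦ ι(H²(⟨w, ·⟩) z)` (`ContinuousRep.zeroTwo`) on Mathlib's continuous cohomology, for an
arbitrary locally compact group `G`, a discrete `G`-module `Ω ≃ ℤ/n` and an additive
`ι : H²(G, Ω) → ℤ/n`:

* `zeroTwo_left_eq_zero_of_devissage` — if (i) for every `W` of order `p` with trivial action an
  invariant `w ∈ W` pairing to zero with all of `H²(G, W^D)` vanishes, and (ii) `H³(G, X) = 0` for
  the finite `p`-primary modules `X` in play (`cd_p G ≤ 2`), then for every finite `p`-primary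
  discrete `G`-module `M` killed by `n` on which `N₀` acts trivially (`G/N₀` a finite `p`-group),
  an invariant `w ∈ M^G` with `ι(H²(⟨w, ·⟩) z) = 0` for all `z ∈ H²(G, M^D)` is `0`.

The induction on `|M|` runs through `0 → N → M → M/N → 0` with `M/N ≅ ℤ/p` trivial
(`exists_quotient_line`): the image of `w` in `M/N` pairs to zero with `H²(G, (M/N)^D)`
(naturality `⟨π w, ·⟩ = ⟨w, ·⟩ ∘ π^D`), so `w ∈ N`; and `H²(G, M^D) → H²(G, N^D)` is onto because
`H³(G, (M/N)^D) = 0` (`IsSES.exists_map_two_eq_of_subsingleton_three` for the dual sequence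
`0 → (M/N)^D → M^D → N^D → 0`), so `w` pairs to zero with `H²(G, N^D)` and vanishes by induction.
Unlike the degree `1` dévissage no connecting homomorphism enters.

## References
* J.-P. Serre, *Galois Cohomology*, Springer, 1997, II §5.2 Thm. 2 (proof). [SerreGaloisCohomology1997]
* J. S. Milne, *Arithmetic Duality Theorems*, 2006, I Cor. 2.3. [MilneADT2006]
-/

noncomputable section

open CategoryTheory Function

universe u

namespace Literature.NumberTheory.GaloisRepresentations

open _root_.TopRep _root_.ContRepresentation _root_.ContinuousCohomology

section ZeroTwoLeft

variable {G : Type u} [Group G] [TopologicalSpace G] [IsTopologicalGroup G] [LocallyCompactSpace G]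
variable {Ω : Type u} [AddCommGroup Ω] [TopologicalSpace Ω] [DiscreteTopology Ω]

omit [TopologicalSpace Ω] [DiscreteTopology Ω] in
/-- `Hom(X, Ω)` is `p`-primary when the finite module `X` is. [folklore] -/
theorem isPrimaryTorsion_homCarrier {p : ℕ} {X : Type u} [AddCommGroup X] [Finite X]
    (hX : IsPrimaryTorsion p X) : IsPrimaryTorsion p (HomCarrier X Ω) := by
  obtain ⟨k, hk⟩ := exists_pow_nsmul_eq_zero_of_isPrimaryTorsion hX
  exact fun f => ⟨k, HomCarrier.nsmul_eq_zero_of_left hk f⟩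

/-- **Naturality of the `(0, 2)` pairing**: for an equivariant `φ : M₁ → M₂`, an invariant
`w ∈ M₁` and `z ∈ H²(G, M₂^D)`, `⟨φ w, z⟩ = ⟨w, H²(φ^D) z⟩`. [folklore] -/
theorem zeroTwo_map {n : ℕ} {M₁ M₂ : Type u} [AddCommGroup M₁] [TopologicalSpace M₁] [DiscreteTopology M₁]
    [Finite M₁] [AddCommGroup M₂] [TopologicalSpace M₂] [DiscreteTopology M₂] [Finite M₂]
    {ρ₁ : ContinuousRep G ℤ M₁} {ρ₂ : ContinuousRep G ℤ M₂} (ω : ContinuousRep G ℤ Ω)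
    (ι : continuousCohomology 2 ω.toTopRep →+ ZMod n) (φ : ρ₁.toTopRep ⟶ ρ₂.toTopRep)
    (w : M₁) (hw : ∀ g : G, ρ₁ g w = w) (hφw : ∀ g : G, ρ₂ g (φ.hom w) = φ.hom w)
    (z : continuousCohomology 2 (ρ₂.homRep ω).toTopRep) :
    ρ₂.zeroTwo ω ι (φ.hom w) hφw z = ρ₁.zeroTwo ω ι w hw (cohomologyMap (ContinuousRep.homRepMap ω φ) 2 z) := by
  obtain ⟨c, rfl⟩ := twoCocycleClass_surjective _ z
  rw [ContinuousRep.zeroTwo_apply, ContinuousRep.zeroTwo_apply, cohomologyMap_twoCocycleClass,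
    cohomologyMap_twoCocycleClass, cohomologyMap_twoCocycleClass]
  exact congrArg (fun y => ι (twoCocycleClass _ y)) (Subtype.ext (ContinuousMap.ext fun _ => rfl))

/-- **Local Tate duality in bidegree `(0, 2)`, the dévissage for the left kernel** (Serre II §5.2,
proof of Thm. 2, `i = 0`): see the module docstring.
[cite: SerreGaloisCohomology1997, II §5.2 Thm. 2 (proof)] [cite: MilneADT2006, I Cor. 2.3] -/
theorem zeroTwo_left_eq_zero_of_devissage (ω : ContinuousRep G ℤ Ω) {n : ℕ} [NeZero n]
    (eΩ : Ω ≃+ ZMod n) (ι : continuousCohomology 2 ω.toTopRep →+ ZMod n) {p : ℕ} [hp : Fact p.Prime]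
    (N₀ : Subgroup G) [N₀.Normal] [Finite (G ⧸ N₀)] (hQ : IsPGroup p (G ⧸ N₀))
    (hline : ∀ (W : Type u) [AddCommGroup W] [TopologicalSpace W] [DiscreteTopology W] [Finite W]
      (τ : ContinuousRep G ℤ W) (hτ : ∀ (g : G) (w : W), τ g w = w), Nat.card W = p →
      ∀ w : W, (∀ z : continuousCohomology 2 (τ.homRep ω).toTopRep, τ.zeroTwo ω ι w (hτ · w) z = 0) → w = 0)
    (h3 : ∀ (X : Type u) [AddCommGroup X] [TopologicalSpace X] [DiscreteTopology X] [Finite X]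
      (τ : ContinuousRep G ℤ X), IsPrimaryTorsion p X → (∀ g ∈ N₀, ∀ x : X, τ g x = x) →
      Subsingleton (continuousCohomology 3 (τ.homRep ω).toTopRep))
    (M : Type u) [AddCommGroup M] [TopologicalSpace M] [DiscreteTopology M] [Finite M]
    (ρ : ContinuousRep G ℤ M) (hpM : IsPrimaryTorsion p M) (hM : ∀ m : M, n • m = 0)
    (hN₀ : ∀ g ∈ N₀, ∀ m : M, ρ g m = m) (w : M) (hw : ∀ g : G, ρ g w = w)
    (hz : ∀ z : continuousCohomology 2 (ρ.homRep ω).toTopRep, ρ.zeroTwo ω ι w hw z = 0) : w = 0 := by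
  classical
  suffices key : ∀ (k : ℕ) (M : Type u) [AddCommGroup M] [TopologicalSpace M] [DiscreteTopology M]
      [Finite M] (ρ : ContinuousRep G ℤ M), IsPrimaryTorsion p M → (∀ m : M, n • m = 0) →
      (∀ g ∈ N₀, ∀ m : M, ρ g m = m) → Nat.card M = k → ∀ (w : M) (hw : ∀ g : G, ρ g w = w),
      (∀ z : continuousCohomology 2 (ρ.homRep ω).toTopRep, ρ.zeroTwo ω ι w hw z = 0) → w = 0 from
    key _ M ρ hpM hM hN₀ rfl w hw hz
  intro k
  induction k using Nat.strong_induction_on with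
  | _ k ih =>
  intro M _ _ _ _ ρ hpM hM hN₀ hk w hw hz
  by_cases hsub : Subsingleton M
  · exact Subsingleton.elim _ _
  haveI : Nontrivial M := not_subsingleton_iff_nontrivial.1 hsub
  obtain ⟨N, hN, hcard, htriv⟩ := exists_quotient_line N₀ hQ ρ hpM hN₀
  have hSES₂ : IsSES (ContinuousRep.homRepMap ω (ρ.mkQHom N hN))
      (ContinuousRep.homRepMap ω (subtypeHom ρ N hN)) :=
    ContinuousRep.isSES_homRepMap_mkQ_subtype ρ ω N hN eΩ hM
  -- Step 1: the image of `w` in `M/N` pairs to zero with `H²((M/N)^D)`, hence vanishes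
  have h1 : (ρ.mkQHom N hN).hom w = 0 := by
    refine hline (M ⧸ N) (ρ.quotient N hN) htriv hcard _ fun zW => ?_
    exact (zeroTwo_map ω ι (ρ.mkQHom N hN) w hw (fun g => htriv g _) zW).trans (hz _)
  -- Step 2: so `w ∈ N`
  have hwN : w ∈ N := (Submodule.Quotient.mk_eq_zero N).1 h1
  let w₁ : N := ⟨w, hwN⟩
  have hw₁ : ∀ g : G, ρ.subrepresentation N hN g w₁ = w₁ := fun g =>
    Subtype.ext ((ContinuousRep.subrepresentation_apply_coe ρ N hN g w₁).trans (hw g))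
  -- Step 3: `w` pairs to zero with `H²(N^D)`, a quotient of `H²(M^D)` (`H³((M/N)^D) = 0`)
  have hQN₀ : ∀ g ∈ N₀, ∀ q : M ⧸ N, ρ.quotient N hN g q = q := fun g _ q => htriv g q
  haveI := h3 (M ⧸ N) (ρ.quotient N hN) (hpM.quotient N) hQN₀
  have h3' : ∀ zN : continuousCohomology 2 ((ρ.subrepresentation N hN).homRep ω).toTopRep,
      (ρ.subrepresentation N hN).zeroTwo ω ι w₁ hw₁ zN = 0 := by
    intro zN
    obtain ⟨zM, rfl⟩ := hSES₂.exists_map_two_eq_of_subsingleton_three zN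
    exact (zeroTwo_map ω ι (subtypeHom ρ N hN) w₁ hw₁ hw zM).symm.trans (hz zM)
  -- Step 4: induction
  have hNcard : Nat.card N < k := by
    have hmul : Nat.card M = Nat.card N * Nat.card (M ⧸ N) := Submodule.card_eq_card_quotient_mul_card N
    rw [hk, hcard] at hmul
    rw [hmul]
    exact (Nat.lt_mul_iff_one_lt_right Nat.card_pos).2 hp.out.one_lt
  have hNn : ∀ x : N, n • x = 0 := fun x => Subtype.ext (by simp [hM])
  have hNN₀ : ∀ g ∈ N₀, ∀ x : N, ρ.subrepresentation N hN g x = x := fun g hg x =>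
    Subtype.ext (by rw [ContinuousRep.subrepresentation_apply_coe, hN₀ g hg])
  have := ih _ hNcard N (ρ.subrepresentation N hN) (hpM.submodule N) hNn hNN₀ rfl w₁ hw₁ h3'
  exact congrArg Subtype.val this

end ZeroTwoLeft

end Literature.NumberTheory.GaloisRepresentations

end
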